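import Mathlib
import Summits.NavierStokesRegularity.NavierStokesRegularity.Theorems.EulerZoomLiouvillePowerGaugeEulerLiouvilleTimePeriodicTools
import Literature.Analysis.FluidPDE.AxisDistancePowerIntegral
import Literature.Analysis.FluidPDE.ClassicalSolution
import Literature.Analysis.FluidPDE.ClassicalSuitable
import Literature.Analysis.FluidPDE.NSSuitableESSProofs
import Literature.Analysis.FluidPDE.TaoEnstrophyLocalisation
import Literature.Analysis.FluidPDE.TaoEnstrophyLocalisationProofs
import Literature.Analysis.FluidPDE.ElgindiBlowup
import Literature.Analysis.FluidPDE.AxisymmetricEuler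
import HarnessLib

/-!
# Crux `EulerZoomLiouville.PowerGaugeEulerLiouville` (stmt-NavierStokesRegularity-19832), line `swirlfree-ledger`, stub S1:
# WINDOWED DECAY OF THE AXIS LEDGER `|curl u| / r` FROM THE `E`-GAUGE (classical members)

Route №10 `EulerZoomLiouville` (NavierStokesRegularity), crux E.  Line `swirlfree-ledger` (ideator ns-idea-11;
`Cruxes/PowerGaugeEulerLiouville/Lines/swirlfree_ledger.lean`), registered stub `stub_axisLedgerDecay` (S1), proved here with
its signature UNFOLDED in the tree's vocabulary (the line's private abbreviations `InClass`, `LedgerDecay`, `axisLedger` are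
`def`s of the Cruxes file; the statement below is their `δ`-unfolding, so the skeleton fills the stub by `exact`).

THE ESTIMATE.  For a member `(u, p, H, c)` of Seregin's power-gauged ancient Euler class (`0 < ρ ≤ 1/2`) that is a CLASSICAL Euler
solution on `(−∞, 0) × ℝ³`, and every exponent `q ∈ (6/(6+ρ), 1)`,
`∫_{−a²}^{0} ∫_{B(0,a)} (|curl u(τ,x)| / r(x))^q dx dτ ≤ C · a^{5 − 3q − qρ/2}` for all `a ≥ 1` (`r` = distance to the `x₂`-axis).
Proof: the weak spatial gradient of a classical member is the classical one a.e. (`hasWeakSpatialGradientOn_of_contDiffOn` +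
`HasWeakSpatialGradientOn.ae_eq`), so the `E`-gauge reads `∫_{Q(a)} |∇u|²_F ≤ c a^{1−ρ}` (`TimePeriodic.setLIntegral_window_le_of_gaugeE`);
pointwise `|curl u| ≤ 4‖∇u‖ ≤ 4|∇u|_F`; Hölder on `Q(a) = (−a²,0) × B(a)` with the exponents `2/q` and `2/(2−q)` against the axis weight
`r^{−q}`, whose `2/(2−q)`-th power `r^{−s}`, `s = 2q/(2−q) < 2`, has `∫_{B(a)} r^{−s} ≤ C_s a^{3−s}`
(`Literature.Analysis.FluidPDE.lintegral_inv_cylRadius_rpow_ball_le`, Nazarov–Uraltseva); the exponents add up to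
`(1−ρ)q/2 + (5−s)(2−q)/2 = 5 − 3q − qρ/2`.  Only `0 < q < 1` and the `E`-gauge are used (`ρ ≤ 1/2`, `q > 6/(6+ρ)`, the local energy
inequality and the `A`/`D`-gauges are carried but idle).

* `ofReal_div_cylRadius_rpow_le` — pointwise splitting `(y/r)^q ≤ y^q · r^{−q}` in `ℝ≥0∞` (junk `y/0 = 0` on the axis);
* `sq_norm_curl_le_frobeniusNormSq` — `|curl v(x)|² ≤ 16 |∇v(x)|²_F`;
* `weakGradient_ae_eq_fderiv_of_classical` — `H = ∇u` a.e. on the slab for a classical member;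
* `lintegral_window_axisWeight_le` — `∫_{(−a²,0)×B(a)} r^{−s} ≤ a² · C_s a^{3−s}`;
* **`axisLedgerDecay_of_classical`** — the stub signature, unfolded.

WHAT THIS IS NOT: not NS, not the crux — a helper `--supports` stmt-19832 on the line `swirlfree-ledger`; no summit statement is
proved here.  [folklore; NazarovUraltseva2012 §4 (the weight bound); CaffarelliKohnNirenberg1982 §2 (the scaled dissipation `E`)]
-/

noncomputable section

-- flat `Theorems/<Route><Decl>…` files of one crux share the namespace of the crux (tree convention)
set_option linter.dupNamespace false

open MeasureTheory Set Filter Topology Metric Function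
open scoped NNReal ENNReal

namespace Summit.NavierStokesRegularity.NavierStokesRegularity.Theorems.PowerGaugeEulerLiouville.SwirlfreeLedger

open Literature.Analysis Literature.Analysis.FluidPDE

variable {u : ℝ → EuclideanSpace ℝ (Fin 3) → EuclideanSpace ℝ (Fin 3)} {p : ℝ → EuclideanSpace ℝ (Fin 3) → ℝ}
  {H : ℝ → EuclideanSpace ℝ (Fin 3) → EuclideanSpace ℝ (Fin 3) →L[ℝ] EuclideanSpace ℝ (Fin 3)}

/-! ### Pointwise algebra -/

/-- Splitting of the ledger density in `ℝ≥0∞`: `ofReal ((y / r)^q) ≤ ofReal (y^q) · ofReal (r^{−q})` for `y, r ≥ 0`, `q > 0`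
(equality off the axis; on the axis `r = 0` the left side is the junk value `ofReal ((y/0)^q) = 0`). [folklore] -/
theorem ofReal_div_rpow_le {y r q : ℝ} (hy : 0 ≤ y) (hr : 0 ≤ r) (hq : 0 < q) :
    ENNReal.ofReal ((y / r) ^ q) ≤ ENNReal.ofReal (y ^ q) * ENNReal.ofReal (r ^ (-q)) := by
  rcases hr.eq_or_lt with h0 | hpos
  · rw [← h0, div_zero, Real.zero_rpow hq.ne', ENNReal.ofReal_zero]
    exact zero_le
  · rw [Real.div_rpow hy hr, Real.rpow_neg hr, div_eq_mul_inv,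
      ENNReal.ofReal_mul (Real.rpow_nonneg hy _)]

/-- `|curl v(x)|² ≤ 16 |∇v(x)|²_F`: the crude bound `|curl v| ≤ 4‖∇v‖` (`norm_curl_le_four_mul`) and the comparison of the operator
norm with the Frobenius norm (`sq_opNorm_le_frobeniusNormSq`). [folklore] -/
theorem sq_norm_curl_le_frobeniusNormSq (v : EuclideanSpace ℝ (Fin 3) → EuclideanSpace ℝ (Fin 3))
    (x : EuclideanSpace ℝ (Fin 3)) : ‖curl v x‖ ^ 2 ≤ 16 * frobeniusNormSq (fderiv ℝ v x) := by
  have h1 := norm_curl_le_four_mul v x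
  have h2 := sq_opNorm_le_frobeniusNormSq (fderiv ℝ v x)
  have h3 : ‖curl v x‖ ^ 2 ≤ (4 * ‖fderiv ℝ v x‖) ^ 2 := pow_le_pow_left₀ (norm_nonneg _) h1 2
  nlinarith [h3, h2, norm_nonneg (fderiv ℝ v x)]

/-! ### The weak gradient of a classical member is the classical gradient -/

/-- **For a classical Euler solution on the past, a weak spatial gradient `H` on the slab `(−∞,0) × ℝ³` IS `∇u` a.e.**: the slice
derivative `(t,x) ↦ D(u t)(x)` of the jointly `C^∞` velocity is itself a weak spatial gradient on the slab
(`hasWeakSpatialGradientOn_of_contDiffOn`), and weak spatial gradients are a.e. unique (`HasWeakSpatialGradientOn.ae_eq`).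
[cite: CaffarelliKohnNirenberg1982, §2 (2.1); Evans2010, §5.2.1] -/
theorem weakGradient_ae_eq_fderiv_of_classical
    (hH : HasWeakSpatialGradientOn (slab (EuclideanSpace ℝ (Fin 3)) (Iio 0) isOpen_Iio) u H)
    (hcl : IsClassicalEulerSolutionOn (Iio 0) 0 u p) :
    ∀ᵐ z ∂(volume.restrict (Iio (0 : ℝ) ×ˢ (univ : Set (EuclideanSpace ℝ (Fin 3))))),
      H z.1 z.2 = fderiv ℝ (u z.1) z.2 := by
  have hu1 : ContDiffOn ℝ 1 (uncurry u) (Iio (0 : ℝ) ×ˢ (univ : Set (EuclideanSpace ℝ (Fin 3)))) :=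
    hcl.smooth_velocity.of_le (by exact_mod_cast le_top)
  have hW : HasWeakSpatialGradientOn (slab (EuclideanSpace ℝ (Fin 3)) (Iio 0) isOpen_Iio) u
      fun t x => fderiv ℝ (u t) x :=
    hasWeakSpatialGradientOn_of_contDiffOn isOpen_Iio (by rw [coe_slab]) hu1
  have hae := hH.ae_eq hW
  rw [coe_slab] at hae
  filter_upwards [hae] with z hz
  exact hz

/-- The `E`-gauge of a classical member, read on the classical gradient: for `a > 0`,
`∫_{(−a²,0)×B(a)} |∇u|²_F ≤ c · a^{1−ρ}` (`TimePeriodic.setLIntegral_window_le_of_gaugeE` + `weakGradient_ae_eq_fderiv_of_classical`).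
[cite: CaffarelliKohnNirenberg1982, §2 (δ(r))] -/
theorem setLIntegral_window_frobenius_fderiv_le {ρ : ℝ} {c : ℝ≥0}
    (hH : HasWeakSpatialGradientOn (slab (EuclideanSpace ℝ (Fin 3)) (Iio 0) isOpen_Iio) u H)
    (hcl : IsClassicalEulerSolutionOn (Iio 0) 0 u p)
    (hE : ∀ a : ℝ, 0 < a →
      ENNReal.ofReal (a ^ ρ) * cknE a (0 : ℝ × EuclideanSpace ℝ (Fin 3)) H ≤ (c : ℝ≥0∞))
    {a : ℝ} (ha : 0 < a) :
    ∫⁻ z in Ioo (-a ^ 2) 0 ×ˢ ball (0 : EuclideanSpace ℝ (Fin 3)) a,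
        ENNReal.ofReal (frobeniusNormSq (fderiv ℝ (u z.1) z.2)) ≤ ENNReal.ofReal ((c : ℝ) * a ^ (1 - ρ)) := by
  have h1 := TimePeriodic.setLIntegral_window_le_of_gaugeE (H := H) (T := a ^ 2) (R := a) ha le_rfl le_rfl (hE a ha)
  refine le_trans (le_of_eq ?_) h1
  refine setLIntegral_congr_fun_ae (measurableSet_Ioo.prod measurableSet_ball) ?_
  have hsub : Ioo (-a ^ 2) 0 ×ˢ ball (0 : EuclideanSpace ℝ (Fin 3)) a ⊆
      Iio (0 : ℝ) ×ˢ (univ : Set (EuclideanSpace ℝ (Fin 3))) :=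
    prod_mono Ioo_subset_Iio_self (subset_univ _)
  have hae := weakGradient_ae_eq_fderiv_of_classical hH hcl
  rw [ae_restrict_iff' (measurableSet_Iio.prod MeasurableSet.univ)] at hae
  filter_upwards [hae] with z hz hzQ
  rw [hz (hsub hzQ)]

/-! ### The axis weight on a window -/

/-- **The axis weight on a parabolic window**: for `0 ≤ s < 2`, with the constant `C_s` of
`lintegral_inv_cylRadius_rpow_ball_le` (`Literature/…/AxisDistancePowerIntegral`), `∫_{(−a²,0)×B(0,a)} r^{−s} = a² ∫_{B(0,a)} r^{−s} ≤ a² · C_s a^{3−s}` (`a > 0`).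
[cite: NazarovUraltseva2012, §4 (c_q, arXiv p. 14)] -/
theorem lintegral_window_axisWeight_le {s : ℝ} {C : ℝ≥0}
    (hC : ∀ (x₀ : EuclideanSpace ℝ (Fin 3)) (r : ℝ), 0 < r →
      ∫⁻ x in ball x₀ r, ENNReal.ofReal (cylRadius x ^ (-s)) ≤ (C : ℝ≥0∞) * ENNReal.ofReal (r ^ (3 - s)))
    {a : ℝ} (ha : 0 < a) :
    ∫⁻ z in Ioo (-a ^ 2) 0 ×ˢ ball (0 : EuclideanSpace ℝ (Fin 3)) a, ENNReal.ofReal (cylRadius z.2 ^ (-s)) ≤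
      ENNReal.ofReal (a ^ 2) * ((C : ℝ≥0∞) * ENNReal.ofReal (a ^ (3 - s))) := by
  have hmeas : Measurable fun x : EuclideanSpace ℝ (Fin 3) => ENNReal.ofReal (cylRadius x ^ (-s)) :=
    (continuous_cylRadius.measurable.pow_const _).ennreal_ofReal
  have hμ : ((volume : Measure ℝ).restrict (Ioo (-a ^ 2) 0)).prod
      ((volume : Measure (EuclideanSpace ℝ (Fin 3))).restrict (ball 0 a)) =
      (volume : Measure (ℝ × EuclideanSpace ℝ (Fin 3))).restrict (Ioo (-a ^ 2) 0 ×ˢ ball 0 a) := by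
    rw [Measure.prod_restrict, ← Measure.volume_eq_prod]
  have hprod : ∫⁻ z in Ioo (-a ^ 2) 0 ×ˢ ball (0 : EuclideanSpace ℝ (Fin 3)) a, ENNReal.ofReal (cylRadius z.2 ^ (-s)) =
      volume (Ioo (-a ^ 2) (0 : ℝ)) * ∫⁻ x in ball (0 : EuclideanSpace ℝ (Fin 3)) a, ENNReal.ofReal (cylRadius x ^ (-s)) := by
    rw [← hμ]
    have h := lintegral_prod_mul (μ := (volume : Measure ℝ).restrict (Ioo (-a ^ 2) 0))
      (ν := (volume : Measure (EuclideanSpace ℝ (Fin 3))).restrict (ball 0 a))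
      (f := fun _ : ℝ => (1 : ℝ≥0∞)) (g := fun x => ENNReal.ofReal (cylRadius x ^ (-s)))
      aemeasurable_const hmeas.aemeasurable
    simp only [one_mul, lintegral_const, Measure.restrict_apply MeasurableSet.univ, univ_inter] at h
    exact h
  rw [hprod, Real.volume_Ioo, show (0 : ℝ) - -a ^ 2 = a ^ 2 by ring]
  gcongr
  exact hC 0 a ha


/-! ### Joint continuity / measurability of the vorticity of a classical member -/

/-- The vorticity `(τ, x) ↦ curl u(τ, x)` of a classical solution is jointly continuous on the slab `(−∞,0) × ℝ³`
(`curl = curlCLM ∘ D`, and the slice gradient of a jointly smooth field is jointly smooth). [folklore] -/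
theorem continuousOn_curl_slab (hcl : IsClassicalEulerSolutionOn (Iio 0) 0 u p) :
    ContinuousOn (fun z : ℝ × EuclideanSpace ℝ (Fin 3) => curl (u z.1) z.2)
      (Iio (0 : ℝ) ×ˢ (univ : Set (EuclideanSpace ℝ (Fin 3)))) := by
  have hD : ContinuousOn (uncurry fun t x => fderiv ℝ (u t) x)
      (Iio (0 : ℝ) ×ˢ (univ : Set (EuclideanSpace ℝ (Fin 3)))) :=
    (hcl.smooth_velocity.fderiv_slice isOpen_Iio.uniqueDiffOn).continuousOn
  exact curlCLM.continuous.comp_continuousOn hD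

/-! ### The Hölder core on one window -/

/-- **Hölder on one parabolic window.**  For a classical member with the `E`-gauge, `0 < q < 2`, `a > 0`, and a constant `C_w`
bounding the axis weight `∫_{B(x₀,r)} r^{−s} ≤ C_w r^{3−s}` for `s = 2q/(2−q)`:
`∫_{(−a²,0)×B(a)} (|curl u|/r)^q ≤ (16 c a^{1−ρ})^{q/2} · (a² C_w a^{3−s})^{(2−q)/2}`
(split `(|ω|/r)^q ≤ |ω|^q r^{−q}`, Hölder with exponents `2/q`, `2/(2−q)`, `|ω|² ≤ 16|∇u|²_F`, the gauge, the weight bound). [folklore] -/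
theorem lintegral_window_ledger_le {ρ : ℝ} {c : ℝ≥0}
    (hH : HasWeakSpatialGradientOn (slab (EuclideanSpace ℝ (Fin 3)) (Iio 0) isOpen_Iio) u H)
    (hcl : IsClassicalEulerSolutionOn (Iio 0) 0 u p)
    (hE : ∀ a : ℝ, 0 < a →
      ENNReal.ofReal (a ^ ρ) * cknE a (0 : ℝ × EuclideanSpace ℝ (Fin 3)) H ≤ (c : ℝ≥0∞))
    {q : ℝ} (hq0 : 0 < q) (hq2 : q < 2) {C : ℝ≥0}
    (hC : ∀ (x₀ : EuclideanSpace ℝ (Fin 3)) (r : ℝ), 0 < r →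
      ∫⁻ x in ball x₀ r, ENNReal.ofReal (cylRadius x ^ (-(2 * q / (2 - q)))) ≤
        (C : ℝ≥0∞) * ENNReal.ofReal (r ^ (3 - 2 * q / (2 - q))))
    {a : ℝ} (ha : 0 < a) :
    ∫⁻ z in Ioo (-a ^ 2) 0 ×ˢ ball (0 : EuclideanSpace ℝ (Fin 3)) a,
        ENNReal.ofReal ((‖curl (u z.1) z.2‖ / cylRadius z.2) ^ q) ≤
      ENNReal.ofReal ((16 * ((c : ℝ) * a ^ (1 - ρ))) ^ (q / 2) *
        (a ^ 2 * ((C : ℝ) * a ^ (3 - 2 * q / (2 - q)))) ^ ((2 - q) / 2)) := by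
  set s : ℝ := 2 * q / (2 - q) with hs
  set Q : Set (ℝ × EuclideanSpace ℝ (Fin 3)) := Ioo (-a ^ 2) 0 ×ˢ ball (0 : EuclideanSpace ℝ (Fin 3)) a with hQ
  have hQm : MeasurableSet Q := measurableSet_Ioo.prod measurableSet_ball
  have hQsub : Q ⊆ Iio (0 : ℝ) ×ˢ (univ : Set (EuclideanSpace ℝ (Fin 3))) :=
    prod_mono Ioo_subset_Iio_self (subset_univ _)
  -- the two factors and their measurability
  set f : ℝ × EuclideanSpace ℝ (Fin 3) → ℝ≥0∞ := fun z => ENNReal.ofReal (‖curl (u z.1) z.2‖ ^ q) with hf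
  set w : ℝ × EuclideanSpace ℝ (Fin 3) → ℝ≥0∞ := fun z => ENNReal.ofReal (cylRadius z.2 ^ (-q)) with hw
  have hcurlm : AEMeasurable (fun z : ℝ × EuclideanSpace ℝ (Fin 3) => curl (u z.1) z.2) (volume.restrict Q) :=
    ((continuousOn_curl_slab hcl).mono hQsub).aemeasurable hQm
  have hrm : Measurable fun z : ℝ × EuclideanSpace ℝ (Fin 3) => cylRadius z.2 :=
    continuous_cylRadius.measurable.comp measurable_snd
  have hfm : AEMeasurable f (volume.restrict Q) := (hcurlm.norm.pow_const q).ennreal_ofReal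
  have hwm : AEMeasurable w (volume.restrict Q) := ((hrm.pow_const (-q)).ennreal_ofReal).aemeasurable
  -- Hölder exponents `P = 2/q`, `P' = 2/(2-q)`
  set P : ℝ := 2 / q with hP
  set P' : ℝ := 2 / (2 - q) with hP'
  have hP0 : 0 < P := by positivity
  have hP'0 : 0 < P' := div_pos two_pos (by linarith)
  have hPP' : P.HolderConjugate P' := by
    rw [Real.holderConjugate_iff]
    refine ⟨(one_lt_div hq0).2 (by linarith), ?_⟩
    rw [hP, hP', inv_div, inv_div]
    ring
  -- (1) split the density and apply Hölder
  have h1 : ∫⁻ z in Q, ENNReal.ofReal ((‖curl (u z.1) z.2‖ / cylRadius z.2) ^ q) ≤ ∫⁻ z in Q, (f * w) z :=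
    lintegral_mono fun z => ofReal_div_rpow_le (norm_nonneg _) (cylRadius_nonneg _) hq0
  have h2 := ENNReal.lintegral_mul_le_Lp_mul_Lq (volume.restrict Q) hPP' hfm hwm
  -- (2) the first factor: `f^P = ofReal |ω|² ≤ ofReal (16 |∇u|²_F)`, then the gauge
  have hA : ∫⁻ z in Q, f z ^ P ≤ ENNReal.ofReal (16 * ((c : ℝ) * a ^ (1 - ρ))) := by
    have hpt : ∀ z : ℝ × EuclideanSpace ℝ (Fin 3),
        f z ^ P ≤ ENNReal.ofReal 16 * ENNReal.ofReal (frobeniusNormSq (fderiv ℝ (u z.1) z.2)) := by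
      intro z
      rw [hf]
      dsimp only
      rw [ENNReal.ofReal_rpow_of_nonneg (Real.rpow_nonneg (norm_nonneg _) _) hP0.le,
        ← Real.rpow_mul (norm_nonneg _), show q * P = 2 by rw [hP]; field_simp, Real.rpow_two,
        ← ENNReal.ofReal_mul (by norm_num)]
      exact ENNReal.ofReal_le_ofReal (sq_norm_curl_le_frobeniusNormSq _ _)
    calc ∫⁻ z in Q, f z ^ P
        ≤ ∫⁻ z in Q, ENNReal.ofReal 16 * ENNReal.ofReal (frobeniusNormSq (fderiv ℝ (u z.1) z.2)) :=
          lintegral_mono hpt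
      _ = ENNReal.ofReal 16 * ∫⁻ z in Q, ENNReal.ofReal (frobeniusNormSq (fderiv ℝ (u z.1) z.2)) :=
          lintegral_const_mul' _ _ ENNReal.ofReal_ne_top
      _ ≤ ENNReal.ofReal 16 * ENNReal.ofReal ((c : ℝ) * a ^ (1 - ρ)) := by
          gcongr
          exact setLIntegral_window_frobenius_fderiv_le hH hcl hE ha
      _ = ENNReal.ofReal (16 * ((c : ℝ) * a ^ (1 - ρ))) := by
          rw [← ENNReal.ofReal_mul (by norm_num)]
  -- (3) the second factor: `w^{P'} = ofReal (r^{-s})`, then the weight bound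
  have hB : ∫⁻ z in Q, w z ^ P' ≤ ENNReal.ofReal (a ^ 2 * ((C : ℝ) * a ^ (3 - s))) := by
    have hpt : ∀ z : ℝ × EuclideanSpace ℝ (Fin 3), w z ^ P' = ENNReal.ofReal (cylRadius z.2 ^ (-s)) := by
      intro z
      rw [hw]
      dsimp only
      rw [ENNReal.ofReal_rpow_of_nonneg (Real.rpow_nonneg (cylRadius_nonneg _) _) hP'0.le,
        ← Real.rpow_mul (cylRadius_nonneg _)]
      congr 2
      rw [hs, hP']
      ring
    calc ∫⁻ z in Q, w z ^ P' = ∫⁻ z in Q, ENNReal.ofReal (cylRadius z.2 ^ (-s)) := lintegral_congr fun z => hpt z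
      _ ≤ ENNReal.ofReal (a ^ 2) * ((C : ℝ≥0∞) * ENNReal.ofReal (a ^ (3 - s))) :=
          lintegral_window_axisWeight_le hC ha
      _ = ENNReal.ofReal (a ^ 2 * ((C : ℝ) * a ^ (3 - s))) := by
          rw [ENNReal.ofReal_mul (sq_nonneg _), ENNReal.ofReal_mul NNReal.zero_le_coe, ENNReal.ofReal_coe_nnreal]
  -- (4) assemble
  have hA0 : 0 ≤ 16 * ((c : ℝ) * a ^ (1 - ρ)) := by positivity
  have hB0 : 0 ≤ a ^ 2 * ((C : ℝ) * a ^ (3 - s)) := by positivity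
  have h1P : 1 / P = q / 2 := by rw [hP, one_div_div]
  have h1P' : 1 / P' = (2 - q) / 2 := by rw [hP', one_div_div]
  calc ∫⁻ z in Q, ENNReal.ofReal ((‖curl (u z.1) z.2‖ / cylRadius z.2) ^ q)
      ≤ ∫⁻ z in Q, (f * w) z := h1
    _ ≤ (∫⁻ z in Q, f z ^ P) ^ (1 / P) * (∫⁻ z in Q, w z ^ P') ^ (1 / P') := h2
    _ ≤ (ENNReal.ofReal (16 * ((c : ℝ) * a ^ (1 - ρ)))) ^ (1 / P) *
          (ENNReal.ofReal (a ^ 2 * ((C : ℝ) * a ^ (3 - s)))) ^ (1 / P') := by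
        gcongr
    _ = ENNReal.ofReal ((16 * ((c : ℝ) * a ^ (1 - ρ))) ^ (q / 2) *
          (a ^ 2 * ((C : ℝ) * a ^ (3 - s))) ^ ((2 - q) / 2)) := by
        rw [h1P, h1P', ENNReal.ofReal_rpow_of_nonneg hA0 (by linarith), ENNReal.ofReal_rpow_of_nonneg hB0 (by linarith),
          ← ENNReal.ofReal_mul (Real.rpow_nonneg hA0 _)]

/-! ### The stub, unfolded -/

/-- **S1 `stub_axisLedgerDecay` of the line `swirlfree-ledger`, signature unfolded** (`InClass ρ u p H c`, `LedgerDecay ρ q u`,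
`axisLedger v x = ‖curl v x‖ / cylRadius x` are the line's abbreviations): for `0 < ρ ≤ 1/2`, a member of the power-gauged class
that is a classical Euler solution on `(−∞,0)`, and `q ∈ (6/(6+ρ), 1)`, there is `C` with
`∫_{−a²}^{0} ∫_{B(0,a)} (|curl u(τ,x)| / r(x))^q dx dτ ≤ C a^{5−3q−qρ/2}` for every `a ≥ 1`.  Tonelli + `lintegral_window_ledger_le` +
exponent bookkeeping `(1−ρ)q/2 + (5−s)(2−q)/2 = 5 − 3q − qρ/2`, `s = 2q/(2−q)`. [folklore] -/
theorem axisLedgerDecay_of_classical :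
    ∀ ρ : ℝ, 0 < ρ → ρ ≤ 1 / 2 →
      ∀ (u : ℝ → EuclideanSpace ℝ (Fin 3) → EuclideanSpace ℝ (Fin 3)) (p : ℝ → EuclideanSpace ℝ (Fin 3) → ℝ)
        (H : ℝ → EuclideanSpace ℝ (Fin 3) → EuclideanSpace ℝ (Fin 3) →L[ℝ] EuclideanSpace ℝ (Fin 3)) (c : ℝ≥0),
        (IsSuitableWeakSolutionOn (slab (EuclideanSpace ℝ (Fin 3)) (Set.Iio 0) isOpen_Iio) 0 0 u p ∧
            HasWeakSpatialGradientOn (slab (EuclideanSpace ℝ (Fin 3)) (Set.Iio 0) isOpen_Iio) u H ∧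
            (∀ a : ℝ, 0 < a →
              ENNReal.ofReal (a ^ (2 * ρ)) * cknA a (0 : ℝ × EuclideanSpace ℝ (Fin 3)) u +
                    ENNReal.ofReal (a ^ ρ) * cknE a (0 : ℝ × EuclideanSpace ℝ (Fin 3)) H +
                  ENNReal.ofReal (a ^ (2 * ρ)) * cknD a (0 : ℝ × EuclideanSpace ℝ (Fin 3)) p ≤ (c : ℝ≥0∞))) →
          IsClassicalEulerSolutionOn (Set.Iio 0) 0 u p →
            ∀ q : ℝ, 6 / (6 + ρ) < q → q < 1 →
              ∃ C : ℝ≥0, ∀ a : ℝ, 1 ≤ a →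
                ∫⁻ τ in Set.Ioo (-a ^ 2) 0, ∫⁻ x in ball (0 : EuclideanSpace ℝ (Fin 3)) a,
                    ENNReal.ofReal ((‖curl (u τ) x‖ / cylRadius x) ^ q) ≤
                  (C : ℝ≥0∞) * ENNReal.ofReal (a ^ (5 - 3 * q - q * ρ / 2)) := by
  intro ρ hρ _hρ2 u p H c hcls hcl q hq1 hq2
  obtain ⟨_hsw, hH, hgauge⟩ := hcls
  have hq0 : 0 < q := lt_trans (by positivity) hq1
  have hq2' : q < 2 := by linarith
  -- the `E`-gauge alone
  have hE : ∀ a : ℝ, 0 < a →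
      ENNReal.ofReal (a ^ ρ) * cknE a (0 : ℝ × EuclideanSpace ℝ (Fin 3)) H ≤ (c : ℝ≥0∞) :=
    fun a ha => (le_add_self.trans le_self_add).trans (hgauge a ha)
  -- the axis weight `r^{-s}`, `s = 2q/(2-q) ∈ [0, 2)`
  set s : ℝ := 2 * q / (2 - q) with hs
  have hs0 : 0 ≤ s := div_nonneg (by linarith) (by linarith)
  have hs2 : s < 2 := by
    rw [hs, div_lt_iff₀ (by linarith)]
    linarith
  obtain ⟨Cw, hCw⟩ := lintegral_inv_cylRadius_rpow_ball_le s hs0 hs2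
  -- the constant
  set K : ℝ := (16 * (c : ℝ)) ^ (q / 2) * (Cw : ℝ) ^ ((2 - q) / 2) with hK
  have hK0 : 0 ≤ K := by positivity
  refine ⟨Real.toNNReal K, fun a ha1 => ?_⟩
  have ha : 0 < a := by linarith
  -- Tonelli: the iterated integral is the integral over the window
  set I : Set ℝ := Set.Ioo (-a ^ 2) 0 with hI
  set B : Set (EuclideanSpace ℝ (Fin 3)) := ball 0 a with hB
  have hQm : MeasurableSet (I ×ˢ B) := measurableSet_Ioo.prod measurableSet_ball
  have hQsub : I ×ˢ B ⊆ Iio (0 : ℝ) ×ˢ (univ : Set (EuclideanSpace ℝ (Fin 3))) :=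
    prod_mono Ioo_subset_Iio_self (subset_univ _)
  have hμ : ((volume : Measure ℝ).restrict I).prod ((volume : Measure (EuclideanSpace ℝ (Fin 3))).restrict B) =
      (volume : Measure (ℝ × EuclideanSpace ℝ (Fin 3))).restrict (I ×ˢ B) := by
    rw [Measure.prod_restrict, ← Measure.volume_eq_prod]
  have hgm : AEMeasurable (uncurry fun (τ : ℝ) (x : EuclideanSpace ℝ (Fin 3)) =>
      ENNReal.ofReal ((‖curl (u τ) x‖ / cylRadius x) ^ q))
      (((volume : Measure ℝ).restrict I).prod ((volume : Measure (EuclideanSpace ℝ (Fin 3))).restrict B)) := by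
    rw [hμ]
    have hcurlm : AEMeasurable (fun z : ℝ × EuclideanSpace ℝ (Fin 3) => curl (u z.1) z.2)
        (volume.restrict (I ×ˢ B)) :=
      ((continuousOn_curl_slab hcl).mono hQsub).aemeasurable hQm
    have hrm : Measurable fun z : ℝ × EuclideanSpace ℝ (Fin 3) => cylRadius z.2 :=
      continuous_cylRadius.measurable.comp measurable_snd
    exact ((hcurlm.norm.div hrm.aemeasurable).pow_const q).ennreal_ofReal
  have hTonelli := lintegral_lintegral hgm
  rw [hμ] at hTonelli
  rw [hTonelli]
  -- the window estimate and the exponent bookkeeping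
  refine (lintegral_window_ledger_le hH hcl hE hq0 hq2' hCw ha).trans (le_of_eq ?_)
  rw [show ((Real.toNNReal K : ℝ≥0) : ℝ≥0∞) = ENNReal.ofReal K from rfl, ← ENNReal.ofReal_mul hK0]
  congr 1
  have h16 : 0 ≤ 16 * (c : ℝ) := by positivity
  have hapow : ∀ e : ℝ, 0 ≤ a ^ e := fun e => Real.rpow_nonneg ha.le e
  have ha2 : a ^ 2 = a ^ (2 : ℝ) := (Real.rpow_two a).symm
  rw [show 16 * ((c : ℝ) * a ^ (1 - ρ)) = (16 * (c : ℝ)) * a ^ (1 - ρ) by ring,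
    Real.mul_rpow h16 (hapow _), ← Real.rpow_mul ha.le,
    show a ^ 2 * ((Cw : ℝ) * a ^ (3 - s)) = (Cw : ℝ) * (a ^ (2 : ℝ) * a ^ (3 - s)) by rw [ha2]; ring,
    ← Real.rpow_add ha, Real.mul_rpow NNReal.zero_le_coe (hapow _), ← Real.rpow_mul ha.le, hK]
  have h2q : (2 : ℝ) - q ≠ 0 := by linarith
  have hexp : (1 - ρ) * (q / 2) + (2 + (3 - s)) * ((2 - q) / 2) = 5 - 3 * q - q * ρ / 2 := by
    rw [hs]
    field_simp
    ring
  rw [← hexp, Real.rpow_add ha]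
  ring

end Summit.NavierStokesRegularity.NavierStokesRegularity.Theorems.PowerGaugeEulerLiouville.SwirlfreeLedger

end
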